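import Summits.BirchSwinnertonDyer.BirchSwinnertonDyer.Theses.SignedLowerHalves
import Literature.NumberTheory.EllipticCurves.BurungaleSkinnerTianWan2024.GreenbergLFunctionSupersingularExistsPRE
import Literature.NumberTheory.EllipticCurves.BurungaleSkinnerTianWan2024.GreenbergMainStatementOPEN
import Literature.NumberTheory.EllipticCurves.SkinnerUrban2014.PAdicUnitPeriodRatioProofs
import HarnessLib

set_option linter.dupNamespace false -- `…BirchSwinnertonDyer.BirchSwinnertonDyer…` is the cell's nested layout (D-0017)
set_option autoImplicit false

/-!
# Crux 19000 `KobayashiLowerHalfSemistable` (route `SignedLowerHalves`, rank 2), skeleton of record «defmu» v4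
# `Cruxes/KobayashiLowerHalfSemistable/Lines/defmu.lean` (sha16 7b97947af97c3fbd, 2026-08-28T13:55:54Z):
# `stub_namedInputsTwo` — (BSTW 6.17 PRE ∧ Kobayashi 1.2 ∧ Kobayashi 4.1 ∧ modular parametrisation ∧ period unit p ≥ 5) ∧ BSTW 9.24 OPEN —
# with the period unit (INPUTS-LIST-2 F5) supplied by Mazur 1978 Cor. 4.1 (F7)
# (LADDER-BSD D-0154 (2) INPUTS, desk `pub/bsd-wall/bsd-inputs`; tranche entry T24 of ADDENDUM-17 §Z)

`--supports stmt-BirchSwinnertonDyer-19000` (helper mode).  Conjunct 1.5 of v4's `stub_namedInputsTwo` (`realPeriodRat_eq_unit_mul_plusPeriod`,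
INPUTS-LIST-2 F5) is a THEOREM of the tree GIVEN `ModularForms.mazur_not_dvd_maninConstant_of_odd` (F7, Mazur 1978 Cor. 4.1) by
`SkinnerUrban2014.realPeriodRat_eq_unit_mul_plusPeriod_of_mazur` (PAdicUnitPeriodRatioProofs.lean:577).  Display after this file: 3 PUB facts +
Mazur + 2 PRE/OPEN binders (count unchanged at 6; F5 replaced by F7, which the X6 / X9 / X10b / ISB / X11a lines already display).
Honest framing: CONDITIONAL on the named facts as typed (two of them UNREFEREED-PREPRINT binders, never citable as theorems); pure glue; closes
nothing by itself; no crux of substance and no summit statement is proved; the Birch–Swinnerton-Dyer conjecture is NOT proved by any of this.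
References: [Mazur1978] Cor. 4.1; [GreenbergVatsal2000] §3 Remark (3.4); [Kobayashi2003] Thms. 1.2, 4.1; [BurungaleSkinnerTianWan2024] Thm. 6.17,
Thm. 9.24 (arXiv:2409.01350v2, OPEN binders).
-/

namespace Summit.BirchSwinnertonDyer.BirchSwinnertonDyer.Theorems.SignedLowerHalves.InputsNamedTwo

open Literature.NumberTheory.EllipticCurves Literature.NumberTheory.EllipticCurves.ModularForms
  Literature.NumberTheory.EllipticCurves.BurungaleSkinnerTianWan2024 Literature.NumberTheory.EllipticCurves.SkinnerUrban2014

/-- **v4's `stub_namedInputsTwo` (VERBATIM) ⟸ its conjuncts other than the period unit, plus Mazur Cor. 4.1.**  CONDITIONAL; closes nothing;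
BSD is not proved. [cite: Mazur1978, Cor. 4.1] [cite: Kobayashi2003, Thm. 1.2, Thm. 4.1] -/
theorem namedInputsTwo_of_mazur
    (h : (thm617_exists_isGreenbergLFunctionAnyRoot₂_supersingular_PRE ∧
      Kobayashi2003.thm12_signedSelmerDual_finite_torsion ∧ Kobayashi2003.thm41_signedCharIdeal_divisibility ∧
      nonempty_modularParametrizationData) ∧ thm924_greenberg_dvd_charIdealXGr₂_awayFromCyc_OPEN)
    (hM : mazur_not_dvd_maninConstant_of_odd) :
    (thm617_exists_isGreenbergLFunctionAnyRoot₂_supersingular_PRE ∧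
      Kobayashi2003.thm12_signedSelmerDual_finite_torsion ∧ Kobayashi2003.thm41_signedCharIdeal_divisibility ∧
      nonempty_modularParametrizationData ∧ realPeriodRat_eq_unit_mul_plusPeriod) ∧
    thm924_greenberg_dvd_charIdealXGr₂_awayFromCyc_OPEN :=
  ⟨⟨h.1.1, h.1.2.1, h.1.2.2.1, h.1.2.2.2, realPeriodRat_eq_unit_mul_plusPeriod_of_mazur hM⟩, h.2⟩

end Summit.BirchSwinnertonDyer.BirchSwinnertonDyer.Theorems.SignedLowerHalves.InputsNamedTwo
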